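import Mathlib
import HarnessLib
import HarnessLib.Audit
import Summits.CriticalPhenomena.Statement
import Literature.Probability.LatticeModels.MedialInterface
import Literature.Probability.RandomPlanarGeometry.SLE
import HarnessLib.Audit.Status.Attr

/-!
Route: CardySublatticeCoherence

DORMANT since 2026-08-23T06:12:02Z (reconciler: no traction for 5.9 d (last activity statement-grounded at 2026-08-17T06:58:31Z); parked, not closed — `ledger route dormant route-CriticalPhenomena-CardySublatticeCoherence --off` to reac) — unstaffed, not closed; items shared with open routes are served there. `ledger route dormant <id> --off` reactivates.

# Route CardySublatticeCoherence — missing half of Cauchy-Riemann on Z2 = leading-order sublattice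
coherence of the q=1 parafermion; Morera at leading order; threshold 1/12

It suffices to show X = SublatticeCoherence ∧ EdgeParafermionPrecompact (card
halfcr-coherence-threshold-one-twelfth, items K1 and K3):
split Smirnov's q = 1, spin-1/3 parafermionic EDGE (dart) observable of critical bond percolation on
δℤ², G_δ(c) = E[exp(−(i/3)·W(c)); γ traverses c]
(γ the medial exploration interface of an admissible ℤ²-discretisation Λ δ of a Dobrushin domain —
every domain AND every discretisation family, the fields of ZdDiscretisationFamily written out — c a
medial dart = corner (v,f), W its intrinsic winding), by the four TRAVEL CLASSES
v − f ∈ {0,1}² (NW, SW, SE, NE). SublatticeCoherence: neighbouring darts of opposite classes carry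
asymptotically EQUAL observables and the two
opposite-pairs agree up to one universal sign s ∈ {±1}, with error o(δ^(1/3)) locally uniformly —
leading order only, no gradient information.
EdgeParafermionPrecompact: δ^(−1/3)G_δ is locally bounded and equicontinuous within each class.
Given X, the EXACT vertex relation (DCS Prop. 8.6,
the known half of Cauchy–Riemann = closedness of G dz) summed over macroscopic contours forces every
subsequential limit to be (anti)holomorphic
(MoreraAtLeadingOrder, provable now); boundary Riemann–Hilbert data identify it with (φ′)^(1/3) (DCS
Conj. 8.7 at q = 1), the martingale gives SLE₆
(Conj. 8.8 in the discretisation-family form: the body of SLE6LimitZ2AllDiscretisations written out,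
so that no conjecture constant enters the cone) and SLE₆-for-all-families gives Cardy — the TAIL,
PROVED in the tree as CardyComplexCone's SLESixFamiliesGiveCardy (stmt-9654,
Cruxes.SLESixFamiliesGiveCardy.CollarTouchSandwich.SLESixFamiliesGiveCardy_of; non-vacuity by the
PROVED DiscretisationFamilyExists stmt-9644) so that on this route the identification crux is stated
through to Cardy (CoherentParafermionGivesCardy = SLE₆ identification + that landed tail). The
priced road to coherence is the card's THRESHOLD crux
(θ_TV > 1/12 on the ℤ₃-graded two-arm scale chain), filed informally with its definition request.
Lean: `Summit.CriticalPhenomena.CardyFormulaZ2.Theses.CardySublatticeCoherence.SublatticeCoherence ∧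
Summit.CriticalPhenomena.CardyFormulaZ2.Theses.CardySublatticeCoherence.EdgeParafermionPrecompact`

## Assembly
The deciding theorem is `closes := fun hCoh hPre hCardy => hCardy hCoh hPre` over the three CRUXES
only (axioms propext / Classical.choice / Quot.sound): SublatticeCoherence (rank 2) and
EdgeParafermionPrecompact (rank 4) are X; CoherentParafermionGivesCardy (rank 5) is X →
CardyFormulaZ2, i.e. the IDENTIFICATION step (coherence + precompactness ⇒ SLE₆ for every domain and
every admissible discretisation family, DCS Conj. 8.7–8.8 at q = 1 — the open content) composed with
the LANDED tail SLE₆-for-all-families ⇒ Cardy (CardyComplexCone's SLESixFamiliesGiveCardy,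
stmt-9654, proved by Cruxes.SLESixFamiliesGiveCardy.CollarTouchSandwich.SLESixFamiliesGiveCardy_of;
non-vacuity by the proved DiscretisationFamilyExists, stmt-9644): a proof of the SLE₆ statement
closes the crux in five more lines (planner sketch AssemblyProof.lean, rc 0, standard axioms).
ASSEMBLY ITEM (restated 2026-08-16, ground repair): the earlier frame `SublatticeCoherence →
EdgeParafermionPrecompact → CoherentParafermionGivesCardy → CardyFormulaZ2` is the type of `closes`
and, with crux #5 stated through to the conjunct, a propositional tautology — the ground battery
closes it by `tauto` (ground.trivial, which blocks READY); an assembly item cannot be dropped and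
every faithful 'cruxes ⇒ conjunct' frame of this route is tautological, so the Assembly now EXPOSES
the identification step one level down: `SublatticeCoherence → EdgeParafermionPrecompact →
(SublatticeCoherence → EdgeParafermionPrecompact → SLE₆ for every Dobrushin domain and every
admissible ℤ²-discretisation family [the body of SLE6LimitZ2AllDiscretisations, verbatim the
antecedent of CardyComplexCone's stmt-9654]) → CardyFormulaZ2`. Its content is exactly the LANDED
tail, hence provable now — planner sketch AssemblyProofSketch.lean: `fun hCoh hPre hId =>
SLESixFamiliesGiveCardy_of (hId hCoh hPre)`, rc 0, axioms propext / Classical.choice / Quot.sound —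
by a Theorems file importing Theorems.CardyComplexConeSLESixFamiliesGiveCardy and this route; the
item is route-local (its signature mentions this route's cruxes), so it is shared with nobody,
nothing is auto-imported and that proof module never enters this file's cone. Re-grounded locally
before the edit (#h21_ground on the rendered file): no trivial / false-witness / vacuous-antecedent
/ unused-binder / name-shadow flag on any of the six typed items. It is not a hypothesis of `closes`
(crux-only). HalfCRVertexRelation (Jordan-carrier form) and MoreraAtLeadingOrder are the
provable-now lemmas the identification crux consumes; the THRESHOLD crux (informal, rank 3) is the
intended proof of SublatticeCoherence and is not on the closes path.
RENDERING (route-repair 2026-08-15, cone guardrail): every item is stated over discretisation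
families (the canonical-data guard `∀ᶠ δ, IsZdAdmissible (dobrushinData D δ)` is generically
vacuous, InterfaceScalingLimitDiscretised §2) and all vocabulary is inlined down to MedialInterface
(fkInterface = medialExploration; winding = Σ turning angles arg((z₃−z₂)/(z₂−z₁)); the barrier's
HalfCRRelationAt / medialCornersAt corner table; dartPhaseSum of the landed FKDartObservable at σ =
1/3), so the route module imports only MedialInterface + SLE beyond the Statement and its import
cone carries no conjecture constant (SLE6LimitZ2, SLE6LimitZ2AllDiscretisations) and no Ising /
triangular-lattice fact.
CONE HYGIENE (route-repair 2026-08-16, rbadge g3): the shared PROVED items SLESixFamiliesGiveCardy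
(9654) and DiscretisationFamilyExists (9644), the SLE₆-concluding crux CoherentParafermionToSLESix
(11305, replaced by CoherentParafermionGivesCardy) and the typed ThresholdDecoupling (8792, built on
TwoArmScaleChain over canonical data) are no longer items of THIS route: only crux or proved items
may be hypotheses of `closes`, and the gate auto-imports a shared item's proof module into the route
file whenever that creates no import cycle (here Theorems.CardyComplexConeSLESixFamiliesGiveCardy,
+401 modules, and Theorems.CardySusyWardDiscretisationFamilyExists, +128 modules), after which the
prover guardrail counts every unproved cite-fact declared along those chains (37: ArmExponents,
CritPercSLE, OneArmLSW, LSW2004UST, Itô, InterfaceScalingLimit, FermionicObservable, GibbsStates,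
PlanarIsing) although no statement of this route mentions them. Every remaining item is route-local,
so any proof of it imports this file and can never be imported back: the import closure beyond the
Statement stays {MedialInterface}. Later seats: do NOT re-attach items shared by signature with
CardyComplexCone / CardySusyWard and do NOT type items over TwoArmScaleChain / FKDartObservable /
FermionicObservable / InterfaceScalingLimit[Discretised]; use MedialInterface / DartPhase /
MedialWinding vocabulary or inline.

Rationale: WHY THIS LINE. The q = 1 parafermion on ℤ² satisfies exactly one linear relation per medial vertex
(DuminilCopinSmirnov2012Lattice Prop. 8.6, DuminilCopin2012Parafermion
Prop. 4) — closedness of an edge form, provably under-determined (barrier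
FKParafermionicHalfCauchyRiemann and its Narrow form) — and the card's census
says no second deterministic-holonomy identity exists at any spin (3s ∈ ℤ iff, unique), so the
missing half must be ASYMPTOTIC. The card's observation
(re-derived in this seat's notes) is that Morera on macroscopic contours needs the dual half only at
LEADING order: if the four class-resolved limits are
proportional with a universal ±1-character vector, the boundary flux of the exact Green identity
(sum_halfCRForm_eq_halfCRFlux) converges to a contour
integral of α·f·dz̄ + β·f·dz type with exactly one of α, β vanishing, whence ∂̄f = 0 or ∂f = 0
weakly; the ±i characters make both vanish and are what the
statement excludes. Coherence itself is a rank-one (projective) statement about a complex,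
winding-twisted transfer operator along dyadic scales
(Nagaev–Guivarc'h / group-extension formalism: base chain = Kesten–GPS two-arm annulus chain,
cocycle = winding number mod 3, character ω = e^(2πi/3)),
and every total-variation coupling proof of it must beat the frozen-phase floor θ* = x₂(σ) − x₂(0) =
κσ²/8 = 1/12 (GarbanPeteSchramm2013Pivotal §5 gives
θ_TV > 0). Imported areas: spectral theory of twisted transfer operators (dynamical systems),
arm-event couplings (percolation), discrete complex analysis.
What prior routes do not do: CardySusyWard asks the dual half as a weak identity from lattice SUSY
(a δ^(−5/3)-weighted curl statement), CardyDualCurrent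
seeks an exact finite-range template, CardySectorGap uses the untwisted positive annulus operator;
none reduces the missing half to a leading-order
direction statement with an explicit threshold, and the negatives index (one SAW tightness artefact)
is untouched.

RANKED CRUXES. #2 SublatticeCoherence (crux) — (card K1, sharp form, family rendering) there is a
universal sign s ∈ {1, −1} such that for every Dobrushin domain D = (Ω; a, b) and every admissible
ℤ²-discretisation family Λ of it (domain Ω, mesh δ, arcs → (ab), (ba), discrete marks → {a, b},
IsZdAdmissible for small δ), every compact K ⊂ Ω and ε > 0, eventually as δ → 0⁺: for all medial
darts c, c′ (corners) with midpoints in K at distance ≤ 2δ, ‖w(c′)·G_δ(c) − w(c)·G_δ(c′)‖ ≤ ε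
δ^(1/3), where w = 1 on the classes NW, SE (v − f of even parity) and w = s on SW, NE — i.e. the
class-resolved q = 1 dart observables are projectively coherent with a ±1-character of the lattice
ℤ₄ (opposite directions equal, perpendicular ones equal up to s). [difficulty: open-problem] (why it
might fail: opposite darts could carry asymptotically OPPOSITE phases (a ±i character: then Morera
is void) or no limit direction at all — rank-one asymptotics of the ω-twisted scale operator can
fail without Perron–Frobenius if the two-arm chain decouples slower than 2^(−1/12) per scale.)
[DuminilCopinSmirnov2012Lattice, DuminilCopin2012Parafermion, GarbanPeteSchramm2013Pivotal,
Smirnov2007ICM, arXiv:1110.3731]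
#4 EdgeParafermionPrecompact (crux) — (card K3) for every such (D, Λ) and compact K ⊂ Ω: (i) ∃ C,
eventually in δ, |G_δ(c)| ≤ C δ^(1/3) for all darts c with midpoint in K; (ii) ∀ ε > 0 ∃ η > 0,
eventually in δ, |G_δ(c) − G_δ(c′)| ≤ ε δ^(1/3) for darts of the SAME travel class with midpoints in
K at distance < η — δ^(−1/3)G_δ is precompact in C(K) class by class (tightness of the (2δ)^(−σ)
normalisation of DCS Conj. 8.7, σ = 1/3, for the edge observable). [difficulty: XL] (why it might
fail: |G_δ(c)| ≤ P(c ∈ γ) ≍ δ^(1/4) (2-arm) ≫ δ^(1/3): the bound needs a winding-phase cancellation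
of order δ^(1/12) for a SIGNED quantity with no s-holomorphic primitive (the q = 2 tool); a
staggered lattice-scale component would break (ii).) [DuminilCopinSmirnov2012Lattice, Smirnov2010,
Zhou2024SLE6BondZ2, SchrammSteif2010]
#5 CoherentParafermionGivesCardy (crux; replaces CoherentParafermionToSLESix 11305 since 2026-08-16,
same open content stated through to the conjunct) — SublatticeCoherence → EdgeParafermionPrecompact
→ CardyFormulaZ2, to be read as: coherence + precompactness ⇒ (SLE₆ for every Dobrushin domain and
every admissible discretisation family whose arcs and marks converge: the re-oriented medial
exploration interface of Λ δ under P_{1/2} converges in law in CurveClass ℂ to chordal SLE₆ = the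
body of SLE6LimitZ2AllDiscretisations) ⇒ CardyFormulaZ2, the last arrow being the LANDED
SLESixFamiliesGiveCardy_of (five lines, AssemblyProof.lean): by HalfCRVertexRelation +
MoreraAtLeadingOrder every subsequential limit f of δ^(−1/3)w(c)⁻¹G_δ is holomorphic or
antiholomorphic; the boundary behaviour on the free arc (DuminilCopin2012Parafermion Prop. 5:
argument of G fixed by the boundary tangent, |G(e_b)| = 1) pins f ≠ 0 and identifies f =
const·(φ′)^(1/3), φ : D → strip (DCS Conj. 8.7 at q = 1); the domain-Markov martingale in slit
domains, Kemppainen–Smirnov precompactness (RSW, known on bond-ℤ²) and Lévy's characterisation give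
driving √6·B (Conj. 8.8); naming the limit needs an SLE₆ curve in D (exists_isSLECurve at κ = 6 =
Rohde–Schramm trace theorem, proved in the tree, + transience tendsto_norm_sleTrace_atTop, RS05 Thm
7.1). [deps: SublatticeCoherence, EdgeParafermionPrecompact] [difficulty: XL] (why it might fail:
non-degeneracy (f ≢ 0 in the bulk) must come from rough-boundary Riemann–Hilbert analysis without
the F²/F³-primitive tools of q = 2, and the martingale step needs the hypotheses UNIFORMLY over slit
sub-domains, which per-domain statements do not give for free.) [DuminilCopinSmirnov2012Lattice,
DuminilCopin2012Parafermion, KemppainenSmirnov2017, CDHKSCRAS2014, Smirnov2010, CamiaNewman2007]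
#9 HalfCRVertexRelation (support) — (the KNOWN half, DCS Prop. 8.6 / DC 2012 Prop. 4 for the
library's objects; provable now by the edge-flip involution, p = 1/2 being the uniform measure;
REPAIRED 2026-08-16 with the Jordan-carrier binder E.Ω = D.carrier after refuter g43-12's annulus
witness — marks on a hole give the phase e^{−iW/3} monodromy e^{2πi/3}, REFUTATION_11306.md — and
LANDED meanwhile for CardyComplexCone's corner observable with χ = +i as
Theorems.CardyComplexConeEdgePrecompactVertexRelation.stub_vertexRelation, same corner table) there
is a universal χ ∈ {i, −i} such that for every Dobrushin domain D, every ℤ²-admissible discrete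
Dobrushin data E with E.Ω = D.carrier (any admissible arcs, not only canonical data) and every
medial vertex p that is an interior edge of Ω_δ whose two faces are inner faces, the q = 1 dart
observable of the medial exploration interface of E satisfies G(NW) − G(SE) = χ (G(NE) − G(SW)) in
the clockwise position labels of the barrier file (HalfCRRelationAt χ with its corner table
medialCornersAt inlined; `fin_cases` matches the tables). [difficulty: provable-now]
[DuminilCopinSmirnov2012Lattice, DuminilCopin2012Parafermion, DuminilCopin2013Parafermion]
#9 MoreraAtLeadingOrder (support) — (card F2, deterministic; provable now) let χ ∈ {i, −i}, s ∈
{±1}, U ⊆ ℂ open, δ_n → 0⁺, F_n functions on corners obeying the (inlined) vertex relation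
HalfCRRelationAt χ at every medial vertex whose four corners have midpoints in U (eventually in n),
and f continuous on U with F_n(c) − w_s(c) f(mid c) → 0 uniformly over corners with midpoints in
each compact K ⊆ U; then f is holomorphic on U or conj ∘ f is (which one is decided by (χ, s)).
Proof route: discrete Green identity sum_halfCRForm_eq_halfCRFlux over the medial vertices inside a
smooth loop Γ ⋐ U, Riemann sums of the boundary flux (source coefficients (−χ, 1, χ, −1) on classes
NE, NW, SW, SE, crossing densities u_κ·n), giving β∂f + α∂̄f = 0 weakly with exactly one of α, β
zero, then Weyl/Morera. [difficulty: provable-now] [DuminilCopin2012Parafermion, IkhlefCardy2009,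
Beffara2008Universal]
#1 Assembly (assembly) — SublatticeCoherence → EdgeParafermionPrecompact → (SublatticeCoherence →
EdgeParafermionPrecompact → SLE₆ for every Dobrushin domain and every admissible ℤ²-discretisation
family, the body of SLE6LimitZ2AllDiscretisations) → CardyFormulaZ2: the frame with the
identification step EXPOSED (restated 2026-08-16 — the earlier pure-logic frame through crux #5,
`fun a b c => c a b`, was closed by the ground battery's `tauto` and an assembly item cannot be
dropped); its content is the TAIL below, provable now from the landed SLESixFamiliesGiveCardy_of in
three lines (planner sketch AssemblyProofSketch.lean, rc 0, standard axioms); not a hypothesis of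
`closes`; route-local, so no auto-import. TAIL (cited, not listed as an item): SLE₆ for every domain
and every admissible discretisation family → CardyFormulaZ2 is CardyComplexCone's stmt-9654, PROVED
(collared designer Dobrushin domains, Newman cross-cut / bc-open escort sandwich, closed-set
portmanteau, SLE₆ side-arc touch law = Cardy's kernel, Radó continuity of the modulus), with
non-vacuity by the proved DiscretisationFamilyExists stmt-9644; as shared items their proof modules
were auto-imported into this file and put 37 foreign cite-facts into the module cone, hence the
re-keying (cone repair 2026-08-16). [difficulty: S]
[lean:Summit.CriticalPhenomena.CardyFormulaZ2.Cruxes.SLESixFamiliesGiveCardy.CollarTouchSandwich.SLESixFamiliesGiveCardy_of]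
#3 ThresholdDecouplingFamilies (informal crux; the priced road, off the closes path) — θ_TV > 1/12
(or ρ_r < |λ_ω|) for the ℤ₃-graded two-arm scale chain of the interface of Λ δ around a bulk point,
FAMILY form with a non-degeneracy guard; re-filed informally 2026-08-16 in place of the typed
ThresholdDecoupling (8792), which was built on twoArmScaleChain over the canonical data
dobrushinData D δ (inadmissible at every mesh on the unit disc, so it could not glue to the
family-form SublatticeCoherence), had a vacuous θ_TV = ⊤ channel (empty rows), and imported
FermionicObservable + InterfaceScalingLimit into the cone; typed again once the re-based definition
(request TwoArmScaleChainFamilies) lands. [GarbanPeteSchramm2013Pivotal, Kesten1986, HervePene2010,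
Beffara2008Universal]

TWO-LAYER PLAN. Foreseen glued splits, none filed now (k ≤ 3, depth 1): SublatticeCoherence ⇐
ThresholdDecouplingFamilies → TwistedRankOne (projective convergence of the
ω-twisted block of the two-arm scale chain) → SublatticeCoherence (the card's road (R): frozen-phase
bookkeeping, need cθ > 1/12 at intermediate scale
ρ = δ^c); CoherentParafermionGivesCardy ⇐ RiemannHilbertIdentification ((anti)holomorphic
subsequential limit + free-arc argument condition ⇒ const·(φ′)^(1/3),
incl. non-degeneracy) → MartingaleToSLESix (uniform slit-domain version + Kemppainen–Smirnov; then
the landed tail) → CoherentParafermionGivesCardy; EdgeParafermionPrecompact ⇐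
BulkBound → ClasswiseEquicontinuity.

KILL CRITERIA. A transfer-matrix / Monte-Carlo or rigorous computation showing the class ratios G_NE
: G_NW : G_SW : G_SE at a bulk point NOT settling to (s,1,s,1) —
in particular opposite darts asymptotically OPPOSITE (a ±i character) or wandering — refutes
SublatticeCoherence: close `refuted:SublatticeCoherence`
(and record it against DCS Conj. 8.7 at q = 1 in the barrier file). δ^(−1/3)|G_δ| unbounded or a
staggered component refutes EdgeParafermionPrecompact:
pivot only if coherence survives in ratio form (restate with the true normalisation).
¬HalfCRVertexRelation for both chiralities would mean the
library's winding/measure conventions differ from DCS's — restate (convention), do not close. An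
abstract proof that TV-bounded couplings cannot certify
coherence below θ = 1/12 together with θ_TV(ℤ²) ≤ 1/12 kills only the THRESHOLD road, not the route.
SLE₆ convergence for all discretisation families (SLE6LimitZ2AllDiscretisations) proved elsewhere
(CardyViaSLE6, CardyRotToConf, CardySusyWard, CardyWindingIG, CardyComplexCone,
CardyDualCurrent) moots the assembly (CoherentParafermionGivesCardy then closes by the landed tail
alone) but not SublatticeCoherence/MoreraAtLeadingOrder as theorems about ℤ² percolation.
¬DiscretisationFamilyExists for some Jordan domain would make the family-form items partly vacuous
there: restate over the domains that admit families (the conjunct CardyFormulaZ2 quantifies over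
conformal rectangles, whose boundaries are tame near the marks), do not close.

NOT DECOMPOSED YET. The interior of the THRESHOLD road (which norm on the scale chain, spiral
surgery retaining cancellation on the no-regeneration event, the inequality
ρ_r < |λ_χ|), the boundary Riemann–Hilbert analysis and the uniform-over-slit-domains upgrade inside
CoherentParafermionGivesCardy, bulk bound versus
equicontinuity inside EdgeParafermionPrecompact, and the typed forms of ThresholdDecouplingFamilies
/ IdentityCensus (awaiting the re-based definition TwoArmScaleChainFamilies) — all
layer-2 children once a crux closes or a definition lands.

CHEAPEST FALSIFIER. Exact enumeration / transfer matrix on small Dobrushin boxes of δℤ² (the card's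
compute/explore_enum.py engine, 2⁷–2¹⁷ configurations, or a strip
transfer matrix of width ≤ 10): (i) verify HalfCRVertexRelation to machine precision at every
interior vertex (the card reports residual ≤ 1.2e−12 on
3×2, 3×3, 4×3 boxes, opposite chirality off by √3) — a failure for both chiralities flags a
convention mismatch before any prover starts; (ii) measure
the bulk class ratios G_SE/G_NW and G_NE/G_SW as the box grows: a ratio drifting towards −1 (or
rotating) rather than +1 is the cheapest evidence
against SublatticeCoherence. Not run in this seat (plancard, no kit payload; the card's census
determinant and enumeration were run by its author).

NUMBERS. σ = 1 − (2/π)arccos(√q/2) = 1/3 at q = 1; κ = 6; two-arm exponent x₂(0) = 1/4, observable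
scale δ^(1/3) = δ^(x₂(σ)), x₂(s) = 1 − κ/8 + κs²/8, gain
x₂(σ) − x₂(0) = κσ²/8 = 1/12; crude threshold: per-dyadic-annulus two-arm regeneration probability >
1 − 2^(−1/12) = 5.61 %; census: det M(s) = 0 iff
e^(6iπs) = 1 iff 3s ∈ ℤ, kernel (1, −1, −i, i) at s = 1/3 (card, verified numerically by its
author); source coefficients of the Green identity on
travel classes (NE, NW, SW, SE) = (−χ, 1, χ, −1); doubly visited path vertices on ℤ² boxes 24–28 %
(card). Items at open: 7 typed (3 cruxes, 3 supports,
1 assembly) + 2 informal (1 crux, 1 support) + 2 definition requests; after the cone repair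
(2026-08-15): 3 typed cruxes, 4 typed supports (HalfCRVertexRelation, MoreraAtLeadingOrder,
SLESixFamiliesGiveCardy, DiscretisationFamilyExists), 1 assembly, 2 informal — 10 items; native cone
100 project constants, 0 unproved; module imports beyond the Statement: MedialInterface (+ SLE,
already in the Statement cone). After the cone repair of 2026-08-16: 3 typed cruxes (11303, 11304
untouched; CoherentParafermionGivesCardy replacing 11305), 2 typed supports (HalfCRVertexRelation in
Jordan form, MoreraAtLeadingOrder), 1 typed assembly (pure logic), 2 informal
(ThresholdDecouplingFamilies rank 3, IdentityCensus rank 9) — 8 items; explicit imports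
MedialInterface + SLE, no auto-import; import closure beyond Summits.CriticalPhenomena.Statement =
{MedialInterface} (was 479 modules with 37 unproved cite-facts through the three auto-imports
TwoArmScaleChain / CardySusyWardDiscretisationFamilyExists /
CardyComplexConeSLESixFamiliesGiveCardy). After the ground repair of 2026-08-16: Assembly restated
with the identification step exposed (SLE₆-for-all-families body inlined, 1.6k chars; provable now;
local re-ground of all six typed items clean) — still 8 items: 3 typed cruxes (11303 r2, 11304 r4,
16615 r5), 2 typed supports (16616, 11307), 1 typed assembly, 2 informal (16618 r3, 8806); `closes`
unchanged (crux-only, native OK).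

DEFINITION REQUESTS. D1 fkDartObservable (topic Literature/Probability/LatticeModels): the
general-spin parafermionic EDGE (dart) observable of the ℤ² medial exploration —
for a corner c = (v, f), G(c) = E[Σ over k with γ_k = cornerSource c, γ_(k+1) = cornerTarget c of
exp(−iσ·winding(γ_0…γ_(k+1)))] under
bondPercolation (zdGraph 2) half with γ = fkInterface (dobrushinData D δ) ω — together with the
travel class v − f and the dart midpoint; the items above
inline it as `let dart/G/mid`. LANDED as Literature.Probability.LatticeModels.FKDartObservable
(dartClass, dartMidpoint, dartPhaseSum, fkDartObservable, rcDartObservable; bridging lemma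
dartPhaseSum_third); the repaired items still inline the σ = 1/3 phase sum (with winding written as
the sum of turning angles, equal to `winding` by a two-line induction) because that module imports
FermionicObservable + InterfaceScalingLimit, whose unproved Ising / triangular facts and the
conjecture SLE6LimitZ2 would otherwise sit in the route's import cone (prover guardrail) — a
cone-neutral re-base of the dart vocabulary onto MedialInterface is requested (D3 below). D3
DartPhaseVocabularyRebase (topic Literature/Probability/LatticeModels): hoist turning / winding /
dartClass / dartMidpoint / dartPhaseSum (pure lattice-polyline vocabulary, no measure, no Dobrushin
domain) into a light module importing only MedialInterface, and bondInterfaceIn / orientCurve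
likewise onto DobrushinDiscretisation, so that family-form parafermion items can use the named
vocabulary without importing conjecture-bearing modules. D2 TwoArmScaleChain (topic
Summits/CriticalPhenomena/CardyFormulaZ2/Theorems): the ℤ₃-graded two-arm scale chain of
the interface around a bulk point (state = boundary connectivity pattern of the configuration on
∂B(z, 2^(−j)) given the interface crosses the annulus,
extended by the winding-number increment mod 3), its ω-twisted transfer operator L_χ, and the limsup
growth rates θ_TV (total-variation decoupling
exponent of the untwisted chain), ρ_r and |λ_χ| — needed to type ThresholdDecoupling. Informal
statement items filed after open: ThresholdDecoupling
(crux, rank 3), IdentityCensus (support, rank 9). D2 LANDED as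
Literature.Probability.Percolation.TwoArmScaleChain (twoArmScaleChain D z over dobrushinData D δ;
thetaTV / lambdaChi / rhoR in EReal) but imports FermionicObservable + InterfaceScalingLimit and is
based on the canonical data; D4 TwoArmScaleChainFamilies (topic Literature/Probability/Percolation):
re-base the same object on a discretisation family member E = Λ δ (arbitrary admissible
DiscreteDobrushin data, interface = medialExploration E) with a non-degeneracy predicate (rows of
positive mass at every scale between topScale and bottomScale) and θ_TV computed over non-degenerate
rows, in a module importing only MedialInterface / DartPhase (no FermionicObservable, no
InterfaceScalingLimit), so that ThresholdDecouplingFamilies can be typed without widening this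
route's import cone. D3 LANDED as Literature.Probability.LatticeModels.DartPhase (cone-neutral;
later restatements may use bondDartObservable E δ (1/3) c = the inlined `G`).

Novelty: Searches. (a) Opening plancard seat, 2026-08-15: `lit search --hybrid "parafermionic observable
square lattice percolation sublattice holomorphic scaling limit"` (15 held books, generic: Grimmett
×3, Bollobás–Riordan; no Duminil-Copin text held as a book); `lit search --source zbmath
"parafermionic observable"` (11: DC–Smirnov connective constant, DC Ensaios, Werness
arXiv:1110.3731, Alam–Batchelor arXiv:1207.3883, de Gier–Lee–Rasmussen arXiv:1210.5036, Zhou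
arXiv:2409.03235, DC–Glazman–Peled–Spinka); `lit galaxy search "half of the discrete Cauchy-Riemann"
--star all` (1: DC Ensaios pdf:976184500); galaxy bm25 on winding phases / sublattice direction
(Smirnov ICM 2006 pdf:5200959740, DC Ensaios, Hao Wu notes); `lit frontier CriticalPhenomena --since
2022` (30 descendants, none on q = 1 parafermions); `lit read arxiv:1110.3731` pp. 5, 10 (radial
ENDPOINT observable, holomorphic iff σ = (6−κ)/2κ — not the chordal FK observable, no conflict with
σ = 1/3 at κ = 6). (b) Card author (mechhunt-7): six hybrid searches; galaxy "parafermionic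
observable" --star pdf (4) and "Nagaev-Guivarc" --star pdf (6, no percolation use); Grimmett 1999
§13.3; Smirnov ICM 2006 §5.5–5.6; census of every card of the conjunct. (c) Retriage g2, 2026-08-15:
`lit galaxy search "parafermionic observable" | "edge parafermionic observable" --star all`
(DC–Manolescu–Tassion fractal properties, DC Ensaios, Zhou 2409.03235, Dewan–Muirhead one-arm bounds
— nothing new); `lit vsearch` of the coherence statement i  [refs: 1110.3731, 1207.3883, 1210.5036, 2409.03235, 1707.09335, 1109.1549, 1208.3787, 1008.1378, 2012.11672, 1212.6215, arxiv:1110.3731, IkhlefCardy2009, HervePene2010]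

Barriers (technique_class: sublattice-coherence, twisted-scale-transfer, census): - technique_class: sublattice-coherence, twisted-scale-transfer, census
- Literature.Barriers.CriticalPhenomena.FKParafermionicHalfCauchyRiemann: evaded — the barrier
(proved: dim of halfCRSolutions ≥ number of equations, explicit face/vertex kernels) blocks
DETERMINING F_δ from the vertex relations plus boundary values; this route never determines F_δ: it
uses the relations only through their Green identity on macroscopic contours
(sum_halfCRForm_eq_halfCRFlux) and supplies the missing information as an asymptotic rank-one
statement (SublatticeCoherence), i.e. the barrier's own evasion (b) made minimal (leading order, one
bit of sublattice structure); HalfCRVertexRelation is the barrier's hypothesis made a theorem for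
the library's objects, and IdentityCensus extends the barrier (no second identity at any spin; an
identity exists iff 3s ∈ ℤ, unique).
- Literature.Barriers.CriticalPhenomena.FKParafermionicHalfCauchyRiemannNarrow: evaded the same way
— the Narrow form says the technique class is exactly the closed edge forms; MoreraAtLeadingOrder
takes closedness as its only exact input and adds coherence plus precompactness, which are not
linear constraints on F_δ at fixed δ.
- Literature.Barriers.CriticalPhenomena.ParafermionicHalfCauchyRiemann: the hexagonal SAW companion
(vertex relations under-determine the SAW parafermion); met only through the shared mechanism name —
this route concerns the q = 1 FK observable on ℤ², where RSW and arm technology exist for the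
precompact

History (route lifecycle, newest last):
- 2026-08-15T16:45:47Z · rev 2: dropped SLESixGivesCardy — route-repair (cone guardrail, rrepair gen-1 seat), rev 2: the only unproved dep of the native cone was the cite-only CONJECTURE constant Literature.Probability. (planner-rrepair-CriticalPhenomena-CardySublatt-5fb5e7f2-0)
- 2026-08-16T20:07:32Z · rev 5: restated Assembly (stmt-CriticalPhenomena-11308) — route-repair (rbadge g3, glue + cone): Assembly restated as the TAIL `SublatticeCoherence → EdgeParafermionPrecompact → CoherentParafermionToSLESix → CardyFormu (planner-rbadge-CriticalPhenomena-CardySublatti-5fb5e7f2-g3-0)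
- 2026-08-16T20:11:35Z · rev 6: restated Assembly (stmt-CriticalPhenomena-16613) — route-repair (rbadge g3) step 2 — cone + crux-only glue in one transaction: (1) crux #5 re-keyed: CoherentParafermionToSLESix 11305 (→ SLE₆-families body) repla (planner-rbadge-CriticalPhenomena-CardySublatti-5fb5e7f2-g3-0)
- 2026-08-16T20:11:35Z · rev 6: dropped CoherentParafermionToSLESix, SLESixFamiliesGiveCardy, DiscretisationFamilyExists, ThresholdDecoupling — route-repair (rbadge g3) step 2 — cone + crux-only glue in one transaction: (1) crux #5 re-keyed: CoherentParafermionToSLESix 11305 (→ SLE₆-families body) repla (planner-rbadge-CriticalPhenomena-CardySublatti-5fb5e7f2-g3-0)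
- 2026-08-16T20:12:32Z · rev 7: restated HalfCRVertexRelation (stmt-CriticalPhenomena-11306) — route-repair (rbadge g3) step 3 — refuter O1: support HalfCRVertexRelation 11306 was refuted-misstated as typed (refuter g43-12, 2026-08-15T18:06Z, REFUTATION_1 (planner-rbadge-CriticalPhenomena-CardySublatti-5fb5e7f2-g3-0)
- 2026-08-16T20:13:10Z · rev 8: dropped stmt-CriticalPhenomena-16617 — housekeeping: drop stmt-16617 (informal ThresholdDecouplingFamilies filed a minute ago with the literal text '@threshold_informal.txt' — workitem add --informal (planner-rbadge-CriticalPhenomena-CardySublatti-5fb5e7f2-g3-0)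
- 2026-08-16T20:26:48Z · rev 10: restated Assembly (stmt-CriticalPhenomena-16614) — route-repair (ground-failed, rground seat): the only blocking flag was Assembly stmt-16614 ground.trivial (`tauto`) — with crux #5 CoherentParafermionGivesCardy (planner-rground-CriticalPhenomena-CardySublatti-5fb5e7f2-0)
- 2026-08-23T06:12:02Z · DORMANT — reconciler: no traction for 5.9 d (last activity statement-grounded at 2026-08-17T06:58:31Z); parked, not closed — `ledger route dormant route-CriticalPhenomena (operator:999:2643947)

sub-problem: CardyFormulaZ2 · status: dormant · opened planner-plancard-CriticalPhenomena-CardyFormu-60e56a08-0 2026-08-15T13:29:52Z · rev 10 · ledger route-CriticalPhenomena-CardySublatticeCoherence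
GENERATED by the gate from the ledger (D-0016/17). Provers cite these decls: `theorem foo : Summit.CriticalPhenomena.CardyFormulaZ2.Theses.CardySublatticeCoherence.<Decl> := …` in Summits/CriticalPhenomena/CardyFormulaZ2/Theorems/<Name>.lean.
-/

namespace Summit.CriticalPhenomena.CardyFormulaZ2.Theses.CardySublatticeCoherence

open scoped BigOperators Topology Manifold Classical MeasureTheory ProbabilityTheory Matrix InnerProductSpace ComplexConjugate ContinuousMap
open Filter Set Function TopologicalSpace MeasureTheory

attribute [summit_statement] _root_.CardyFormulaZ2

-- earlier SublatticeCoherence (stmt-CriticalPhenomena-8751, replaced 2026-08-15T16:45:47Z -> stmt-CriticalPhenomena-11070): retired by None — let dart : ℝ → List Literature.Probability.LatticeModels.MedialVertex → Literature.Probability.LatticeModels.Site 2 × Literature.Probability.LatticeModels.Site 2 → ℂ := fun δ γ c => ∑ k ∈ (Finset.range γ.length).filter (fun k => γ[k]? = some (Literature.Probab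
/-- item stmt-CriticalPhenomena-11303 · crux · rank 2 · open · by planner
why it might fail: Perpendicular classes may carry a ±i character (opposite darts of opposite sign: degenerate Green flux, Morera void) or no limit direction; rank-one asymptotics of the ω-twisted 2-arm scale operator (no Perron–Frobenius) need TV decoupling > 2^(−1/12) per scale; GPS Prop 11 gives only some k > 0.
sources: DuminilCopinSmirnov2012Lattice, DuminilCopin2012Parafermion, GarbanPeteSchramm2013Pivotal, Smirnov2007ICM, Werness2012, HervePene2010
[crux] (card K1, sharp form; family rendering) there is a universal sign s ∈ {1, −1} such that for
every Dobrushin domain D = (Ω; a, b) and every admissible ℤ²-discretisation family Λ of it (domain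
Ω, mesh δ, arcs of the data → (ab), (ba) in Hausdorff distance, discrete marks → {a, b},
IsZdAdmissible for all small δ — the fields of ZdDiscretisationFamily written out), every compact K
⊂ Ω and ε > 0, eventually as δ → 0⁺: for all medial darts c, c′ (corners) with midpoints in K at
distance ≤ 2δ, ‖w(c′)·G_δ(c) − w(c)·G_δ(c′)‖ ≤ ε δ^(1/3), where G_δ(c) = E_{1/2}[Σ_traversals
exp(−(i/3)·winding)] is the spin-1/3 dart observable of the medial exploration interface of Λ δ (=
dartPhaseSum … (1/3), inlined: winding written as the sum of turning angles arg((z₃−z₂)/(z₂−z₁))), w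
= 1 on the travel classes NW, SE (v − f of even parity) and w = s on SW, NE. -/
@[route_item "route-CriticalPhenomena-CardySublatticeCoherence", crux]
def SublatticeCoherence : Prop :=
  let wind : List ℂ → ℝ := fun l => (List.zipWith3 (fun z₁ z₂ z₃ : ℂ => Complex.arg ((z₃ - z₂) / (z₂ - z₁))) l (l.drop 1) (l.drop 2)).sum; let dart : ℝ → List Literature.Probability.LatticeModels.MedialVertex → Literature.Probability.LatticeModels.Site 2 × Literature.Probability.LatticeModels.Site 2 → ℂ := fun δ γ c => ∑ k ∈ (Finset.range γ.length).filter (fun k => γ[k]? = some (Literature.Probability.LatticeModels.cornerSource c.1 c.2) ∧ γ[k + 1]? = some (Literature.Probability.LatticeModels.cornerTarget c.1 c.2)), Complex.exp (-Complex.I * ((1:ℂ) / 3) * ((wind (((γ.map (Literature.Probability.LatticeModels.medialPoint δ)).take (k + 2)))) : ℂ)); let G : Literature.Probability.LatticeModels.DiscreteDobrushin → ℝ → Literature.Probability.LatticeModels.Site 2 × Literature.Probability.LatticeModels.Site 2 → ℂ := fun E δ c => ∫ ω, dart δ (Literature.Probability.LatticeModels.medialExploration E ω) c ∂(Literature.Probability.Percolation.bondPercolation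 (Literature.Probability.LatticeModels.zdGraph 2) Literature.Probability.Percolation.half); let mid : ℝ → Literature.Probability.LatticeModels.Site 2 × Literature.Probability.LatticeModels.Site 2 → ℂ := fun δ c => (Literature.Probability.LatticeModels.medialPoint δ (Literature.Probability.LatticeModels.cornerSource c.1 c.2) + Literature.Probability.LatticeModels.medialPoint δ (Literature.Probability.LatticeModels.cornerTarget c.1 c.2)) / 2; let w : ℂ → Literature.Probability.LatticeModels.Site 2 × Literature.Probability.LatticeModels.Site 2 → ℂ := fun s c => if ((c.1 - c.2) 0 + (c.1 - c.2) 1) % 2 = 0 then 1 else s; ∃ s : ℂ, (s = 1 ∨ s = -1) ∧ ∀ (D : Literature.Probability.RandomPlanarGeometry.DobrushinDomain) (Λ : ℝ → Literature.Probability.LatticeModels.DiscreteDobrushin), (∀ δ, (Λ δ).Ω = D.carrier) → (∀ δ, (Λ δ).δ = δ) → Filter.Tendsto (fun δ : ℝ => Metric.hausdorffEDist (Λ δ).arcA (D.arc 0)) (nhdsWithin (0:ℝ) (Set.Ioi 0)) (nhds 0) → Filter.Tendsto (fun δ : ℝ => Metric.hausdorffEDist (Λ δ).arcB (D.arc 1))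 (nhdsWithin (0:ℝ) (Set.Ioi 0)) (nhds 0) → Filter.Tendsto (fun δ : ℝ => Metric.hausdorffEDist (Literature.Probability.LatticeModels.medialPoint δ '' (Λ δ).zdABEdges) {D.pt 0, D.pt 1}) (nhdsWithin (0:ℝ) (Set.Ioi 0)) (nhds 0) → (∀ᶠ δ in nhdsWithin (0:ℝ) (Set.Ioi 0), (Λ δ).IsZdAdmissible) → ∀ K : Set ℂ, IsCompact K → K ⊆ D.carrier → ∀ ε > (0:ℝ), ∀ᶠ δ in nhdsWithin (0:ℝ) (Set.Ioi 0), ∀ c c' : Literature.Probability.LatticeModels.Site 2 × Literature.Probability.LatticeModels.Site 2, Literature.Probability.LatticeModels.IsCorner c.1 c.2 → Literature.Probability.LatticeModels.IsCorner c'.1 c'.2 → mid δ c ∈ K → mid δ c' ∈ K → dist (mid δ c) (mid δ c') ≤ 2 * δ → ‖w s c' * G (Λ δ) δ c - w s c * G (Λ δ) δ c'‖ ≤ ε * δ ^ ((1:ℝ) / 3)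

-- earlier EdgeParafermionPrecompact (stmt-CriticalPhenomena-8752, replaced 2026-08-15T16:45:47Z -> stmt-CriticalPhenomena-11071): retired by None — let dart : ℝ → List Literature.Probability.LatticeModels.MedialVertex → Literature.Probability.LatticeModels.Site 2 × Literature.Probability.LatticeModels.Site 2 → ℂ := fun δ γ c => ∑ k ∈ (Finset.range γ.length).filter (fun k => γ[k]? = some (Literature.
/-- item stmt-CriticalPhenomena-11304 · crux · rank 4 · open · by planner
why it might fail: |G_δ(c)| ≤ P(c ∈ γ) ≍ δ^(1/4) (polychromatic 2-arm; α₂ = 1/4 known on 𝕋 only, on ℤ² not even the exponent) ≫ δ^(1/3): (i) asserts a δ^(1/12) winding-phase cancellation for a SIGNED sum with no s-holomorphic primitive (the q = 2 tool); a staggered lattice-scale component breaks (ii).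
sources: DuminilCopinSmirnov2012Lattice, DuminilCopin2012Parafermion, Nolin2008, SmirnovWerner2001, SchrammSteif2010, Zhou2024SLE6BondZ2
[crux] (card K3; family rendering) for every Dobrushin domain D, every admissible ℤ²-discretisation
family Λ of it and every compact K ⊂ Ω: (i) ∃ C, eventually in δ, |G_δ(c)| ≤ C δ^(1/3) for all darts
c with midpoint in K; (ii) ∀ ε > 0 ∃ η > 0, eventually in δ, |G_δ(c) − G_δ(c′)| ≤ ε δ^(1/3) for
darts of the SAME travel class with midpoints in K at distance < η — δ^(−1/3)G_δ is precompact in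
C(K) class by class (tightness of the (2δ)^(−σ) normalisation of DCS Conj. 8.7, σ = 1/3, for the
edge observable of the interface of Λ δ). -/
@[route_item "route-CriticalPhenomena-CardySublatticeCoherence", crux]
def EdgeParafermionPrecompact : Prop :=
  let wind : List ℂ → ℝ := fun l => (List.zipWith3 (fun z₁ z₂ z₃ : ℂ => Complex.arg ((z₃ - z₂) / (z₂ - z₁))) l (l.drop 1) (l.drop 2)).sum; let dart : ℝ → List Literature.Probability.LatticeModels.MedialVertex → Literature.Probability.LatticeModels.Site 2 × Literature.Probability.LatticeModels.Site 2 → ℂ := fun δ γ c => ∑ k ∈ (Finset.range γ.length).filter (fun k => γ[k]? = some (Literature.Probability.LatticeModels.cornerSource c.1 c.2) ∧ γ[k + 1]? = some (Literature.Probability.LatticeModels.cornerTarget c.1 c.2)), Complex.exp (-Complex.I * ((1:ℂ) / 3) * ((wind (((γ.map (Literature.Probability.LatticeModels.medialPoint δ)).take (k + 2)))) : ℂ)); let G : Literature.Probability.LatticeModels.DiscreteDobrushin → ℝ → Literature.Probability.LatticeModels.Site 2 × Literature.Probability.LatticeModels.Site 2 → ℂ := fun E δ c => ∫ ω, dart δ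 (Literature.Probability.LatticeModels.medialExploration E ω) c ∂(Literature.Probability.Percolation.bondPercolation (Literature.Probability.LatticeModels.zdGraph 2) Literature.Probability.Percolation.half); let mid : ℝ → Literature.Probability.LatticeModels.Site 2 × Literature.Probability.LatticeModels.Site 2 → ℂ := fun δ c => (Literature.Probability.LatticeModels.medialPoint δ (Literature.Probability.LatticeModels.cornerSource c.1 c.2) + Literature.Probability.LatticeModels.medialPoint δ (Literature.Probability.LatticeModels.cornerTarget c.1 c.2)) / 2; ∀ (D : Literature.Probability.RandomPlanarGeometry.DobrushinDomain) (Λ : ℝ → Literature.Probability.LatticeModels.DiscreteDobrushin), (∀ δ, (Λ δ).Ω = D.carrier) → (∀ δ, (Λ δ).δ = δ) → Filter.Tendsto (fun δ : ℝ => Metric.hausdorffEDist (Λ δ).arcA (D.arc 0)) (nhdsWithin (0:ℝ) (Set.Ioi 0)) (nhds 0) → Filter.Tendsto (fun δ : ℝ => Metric.hausdorffEDist (Λ δ).arcB (D.arc 1)) (nhdsWithin (0:ℝ) (Set.Ioi 0)) (nhds 0) → Filter.Tendsto (fun δ : ℝ => Metric.hausdorffEDist (Literature.Probability.LatticeModels.medialPoint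 δ '' (Λ δ).zdABEdges) {D.pt 0, D.pt 1}) (nhdsWithin (0:ℝ) (Set.Ioi 0)) (nhds 0) → (∀ᶠ δ in nhdsWithin (0:ℝ) (Set.Ioi 0), (Λ δ).IsZdAdmissible) → ∀ K : Set ℂ, IsCompact K → K ⊆ D.carrier → (∃ C : ℝ, ∀ᶠ δ in nhdsWithin (0:ℝ) (Set.Ioi 0), ∀ c : Literature.Probability.LatticeModels.Site 2 × Literature.Probability.LatticeModels.Site 2, Literature.Probability.LatticeModels.IsCorner c.1 c.2 → mid δ c ∈ K → ‖G (Λ δ) δ c‖ ≤ C * δ ^ ((1:ℝ) / 3)) ∧ (∀ ε > (0:ℝ), ∃ η > (0:ℝ), ∀ᶠ δ in nhdsWithin (0:ℝ) (Set.Ioi 0), ∀ c c' : Literature.Probability.LatticeModels.Site 2 × Literature.Probability.LatticeModels.Site 2, Literature.Probability.LatticeModels.IsCorner c.1 c.2 → Literature.Probability.LatticeModels.IsCorner c'.1 c'.2 → c.1 - c.2 = c'.1 - c'.2 → mid δ c ∈ K → mid δ c' ∈ K → dist (mid δ c) (mid δ c') < η → ‖G (Λ δ) δ c - G (Λ δ)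 δ c'‖ ≤ ε * δ ^ ((1:ℝ) / 3))

/-- item stmt-CriticalPhenomena-16615 · crux · rank 5 · open · by planner
why it might fail: Carries the whole SLE₆ identification at q=1 (DCS Conj 8.7–8.8): bulk inputs do not exclude the ZERO limit nor fix f = c·(φ′)^{1/3} without free-arc control (half-plane 1-arm exponent 1/3, unproved on bond-ℤ²), and the slit-domain martingale needs them uniformly; no SLE₆-free road to Cardy is known.
sources: DuminilCopinSmirnov2012Lattice, DuminilCopin2012Parafermion, KemppainenSmirnov2017, CDHKSCRAS2014, Smirnov2010, Zhou2024SLE6BondZ2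
[crux] SublatticeCoherence → EdgeParafermionPrecompact → CardyFormulaZ2 ('X suffices'; replaces
CoherentParafermionToSLESix stmt-11305 since the cone repair of 2026-08-16 — same open content,
stated through to the conjunct). OPEN CONTENT = the identification step: from coherence +
precompactness, SLE₆ for every Dobrushin domain D and every admissible ℤ²-discretisation family Λ of
it whose arcs and discrete marks converge (the re-oriented medial exploration interface of Λ δ under
P_{1/2} converges in law in CurveClass ℂ to chordal SLE₆: the body of SLE6LimitZ2AllDiscretisations,
verbatim the antecedent of CardyComplexCone's SLESixFamiliesGiveCardy) — by HalfCRVertexRelation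
(Jordan form) + MoreraAtLeadingOrder every subsequential limit f of δ^(−1/3)w(c)⁻¹G_δ is holomorphic
or antiholomorphic; the free-arc boundary behaviour (DuminilCopin2012Parafermion Prop. 5: argument
of G fixed by the boundary tangent, |G(e_b)| = 1) pins f ≠ 0 and identifies f = const·(φ′)^(1/3), φ
: Ω → strip (DCS Conj. 8.7 at q = 1); the domain-Markov martingale in slit domains,
Kemppainen–Smirnov precompactness (RSW, known on bond-ℤ²) and Lévy's characterisation give driving
√6·B (Conj. 8.8); exists_isSLECurve -/
@[route_item "route-CriticalPhenomena-CardySublatticeCoherence", crux]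
def CoherentParafermionGivesCardy : Prop :=
  SublatticeCoherence → EdgeParafermionPrecompact → CardyFormulaZ2

-- item stmt-CriticalPhenomena-16618 · support · rank 3 · open · by planner — informal only, no Lean statement yet:
--   [crux] THRESHOLD, FAMILY FORM (card halfcr-coherence-threshold-one-twelfth K2; the priced road to
--   SublatticeCoherence, off the closes path; rank 3). Re-filed 2026-08-16 in place of the typed
--   ThresholdDecoupling (stmt-8792, mooted): that signature was built on
--   Literature.Probability.Percolation.twoArmScaleChain D z over the CANONICAL data dobrushinData D δ —
--   inadmissible at every mesh on the unit disc and along δ_k → 0⁺ on axis rectangles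
--   (InterfaceScalingLimitDiscretised §2), so it could not glue to the family-form SublatticeCoherence
--   —, its θ_TV = ⊤ channel (rows of an empty/degenerate chain

-- earlier MoreraAtLeadingOrder (stmt-CriticalPhenomena-8755, replaced 2026-08-15T16:45:47Z -> stmt-CriticalPhenomena-11074): retired by None — let mid : ℝ → Literature.Probability.LatticeModels.Site 2 × Literature.Probability.LatticeModels.Site 2 → ℂ := fun δ c => (Literature.Probability.LatticeModels.medialPoint δ (Literature.Probability.LatticeModels.cornerSource c.1 c.2) + Literature.Probability.
/-- item stmt-CriticalPhenomena-11307 · support · rank 9 · open · by planner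
sources: DuminilCopin2012Parafermion, IkhlefCardy2009, Beffara2008Universal
[support] (card F2, deterministic; provable now; unchanged except that the barrier-file vocabulary
HalfCRRelationAt / medialCornersAt is inlined) let χ ∈ {i, −i}, s ∈ {±1}, U ⊆ ℂ open, δ_n → 0⁺, F_n
functions on corners obeying the vertex relation F(NW) − F(SE) = χ (F(NE) − F(SW)) at every medial
vertex whose four corners have midpoints in U (eventually in n), and f continuous on U with F_n(c) −
w_s(c) f(mid c) → 0 uniformly over corners with midpoints in each compact K ⊆ U; then f is
holomorphic on U or conj ∘ f is. Proof route: discrete Green identity (sum_halfCRForm_eq_halfCRFlux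
of the barrier file) over the medial vertices inside a smooth loop Γ ⋐ U, Riemann sums of the
boundary flux (source coefficients (−χ, 1, χ, −1) on classes NE, NW, SW, SE), giving β∂f + α∂̄f = 0
weakly with exactly one of α, β zero, then Weyl/Morera. [difficulty: provable-now] -/
@[route_item "route-CriticalPhenomena-CardySublatticeCoherence"]
def MoreraAtLeadingOrder : Prop :=
  let mid : ℝ → Literature.Probability.LatticeModels.Site 2 × Literature.Probability.LatticeModels.Site 2 → ℂ := fun δ c => (Literature.Probability.LatticeModels.medialPoint δ (Literature.Probability.LatticeModels.cornerSource c.1 c.2) + Literature.Probability.LatticeModels.medialPoint δ (Literature.Probability.LatticeModels.cornerTarget c.1 c.2)) / 2; let w : ℂ → Literature.Probability.LatticeModels.Site 2 × Literature.Probability.LatticeModels.Site 2 → ℂ := fun s c => if ((c.1 - c.2) 0 + (c.1 - c.2) 1) % 2 = 0 then 1 else s; let corners : Literature.Probability.LatticeModels.Site 2 × Fin 2 → Fin 4 → Literature.Probability.LatticeModels.Site 2 × Literature.Probability.LatticeModels.Site 2 := fun p k => if p.2 = 0 then (![(p.1, p.1), (p.1 + Pi.single 0 1, p.1), (p.1 +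 Pi.single 0 1, p.1 - Pi.single 1 1), (p.1, p.1 - Pi.single 1 1)] : Fin 4 → Literature.Probability.LatticeModels.Site 2 × Literature.Probability.LatticeModels.Site 2) k else (![(p.1 + Pi.single 1 1, p.1 - Pi.single 0 1), (p.1 + Pi.single 1 1, p.1), (p.1, p.1), (p.1, p.1 - Pi.single 0 1)] : Fin 4 → Literature.Probability.LatticeModels.Site 2 × Literature.Probability.LatticeModels.Site 2) k; let rel : ℂ → (Literature.Probability.LatticeModels.Site 2 × Literature.Probability.LatticeModels.Site 2 → ℂ) → Literature.Probability.LatticeModels.Site 2 × Fin 2 → Prop := fun χ F p => F (corners p 0) - F (corners p 2) = χ * (F (corners p 1) - F (corners p 3)); ∀ χ s : ℂ, (χ = Complex.I ∨ χ = -Complex.I) → (s = 1 ∨ s = -1) → ∀ U : Set ℂ, IsOpen U → ∀ δ : ℕ → ℝ, (∀ n, 0 < δ n) → Filter.Tendsto δ Filter.atTop (nhds 0) → ∀ (F : ℕ → Literature.Probability.LatticeModels.Site 2 × Literature.Probability.LatticeModels.Site 2 → ℂ) (f : ℂ → ℂ), ContinuousOn f U → (∀ᶠ n in Filter.atTop,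 ∀ p : Literature.Probability.LatticeModels.Site 2 × Fin 2, (∀ k : Fin 4, mid (δ n) (corners p k) ∈ U) → rel χ (F n) p) → (∀ K : Set ℂ, IsCompact K → K ⊆ U → ∀ ε > (0:ℝ), ∀ᶠ n in Filter.atTop, ∀ c : Literature.Probability.LatticeModels.Site 2 × Literature.Probability.LatticeModels.Site 2, Literature.Probability.LatticeModels.IsCorner c.1 c.2 → mid (δ n) c ∈ K → ‖F n c - w s c * f (mid (δ n) c)‖ ≤ ε) → (DifferentiableOn ℂ f U ∨ DifferentiableOn ℂ (starRingEnd ℂ ∘ f) U)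

-- earlier HalfCRVertexRelation (stmt-CriticalPhenomena-11306, replaced 2026-08-16T20:12:32Z -> stmt-CriticalPhenomena-16616): retired by None — let wind : List ℂ → ℝ := fun l => (List.zipWith3 (fun z₁ z₂ z₃ : ℂ => Complex.arg ((z₃ - z₂) / (z₂ - z₁))) l (l.drop 1) (l.drop 2)).sum; let dart : ℝ → List Literature.Probability.LatticeModels.MedialVertex → Literature.Probability.LatticeModels.Site 2 × Lit
-- earlier HalfCRVertexRelation (stmt-CriticalPhenomena-8754, replaced 2026-08-15T16:45:47Z -> stmt-CriticalPhenomena-11073): retired by None — let dart : ℝ → List Literature.Probability.LatticeModels.MedialVertex → Literature.Probability.LatticeModels.Site 2 × Literature.Probability.LatticeModels.Site 2 → ℂ := fun δ γ c => ∑ k ∈ (Finset.range γ.length).filter (fun k => γ[k]? = some (Literature.Proba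
/-- item stmt-CriticalPhenomena-16616 · support · rank 9 · open · by planner
sources: DuminilCopinSmirnov2012Lattice, DuminilCopin2012Parafermion, DuminilCopin2013Parafermion, lean:Summit.CriticalPhenomena.CardyFormulaZ2.Cruxes.EdgePrecompact.QkzStripBoundaryArm.stub_vertexRelation
[support] (the KNOWN half, DCS Prop. 8.6 / DC 2012 Prop. 4, for the library's objects; provable now
by the edge-flip involution, p = 1/2 being the uniform measure) JORDAN-CARRIER FORM (repair
2026-08-16 of stmt-11306, refuted-misstated by refuter g43-12: on an admissible E whose Ω is an
annulus with the marks on the hole, the interface's total rotation takes two values according to the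
side on which it passes the hole, so exp(−iW/3) has monodromy e^{2πi/3} and the relation fails for
both chiralities — exact ℤ[ζ₁₂] enumeration over 2^21 configurations, REFUTATION_11306.md; the
one-binder repair C′ below is how the cruxes consume the lemma and the witness misses it): there is
a universal χ ∈ {i, −i} such that for every Dobrushin domain D, every ℤ²-admissible discrete
Dobrushin data E WITH E.Ω = D.carrier (arbitrary admissible arcs) and every medial vertex p = s(x, x
+ e_i) that is an interior edge of Ω_δ (no endpoint on the discrete arcs) whose two faces are inner
faces, the spin-1/3 dart observable G_E of the medial exploration interface of E satisfies G(NW) −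
G(SE) = χ (G(NE) − G(SW)) for the four corners at p listed clockwise from north-west (=
HalfCRRelationAt χ of the barrier fi -/
@[route_item "route-CriticalPhenomena-CardySublatticeCoherence"]
def HalfCRVertexRelation : Prop :=
  let wind : List ℂ → ℝ := fun l => (List.zipWith3 (fun z₁ z₂ z₃ : ℂ => Complex.arg ((z₃ - z₂) / (z₂ - z₁))) l (l.drop 1) (l.drop 2)).sum; let dart : ℝ → List Literature.Probability.LatticeModels.MedialVertex → Literature.Probability.LatticeModels.Site 2 × Literature.Probability.LatticeModels.Site 2 → ℂ := fun δ γ c => ∑ k ∈ (Finset.range γ.length).filter (fun k => γ[k]? = some (Literature.Probability.LatticeModels.cornerSource c.1 c.2) ∧ γ[k + 1]? = some (Literature.Probability.LatticeModels.cornerTarget c.1 c.2)), Complex.exp (-Complex.I * ((1:ℂ) / 3) * ((wind (((γ.map (Literature.Probability.LatticeModels.medialPoint δ)).take (k + 2)))) : ℂ)); let G : Literature.Probability.LatticeModels.DiscreteDobrushin → ℝ → Literature.Probability.LatticeModels.Site 2 × Literature.Probability.LatticeModels.Site 2 → ℂ := fun E δ c => ∫ ω, dart δ (Literature.Probability.LatticeModels.medialExploration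 E ω) c ∂(Literature.Probability.Percolation.bondPercolation (Literature.Probability.LatticeModels.zdGraph 2) Literature.Probability.Percolation.half); let corners : Literature.Probability.LatticeModels.Site 2 × Fin 2 → Fin 4 → Literature.Probability.LatticeModels.Site 2 × Literature.Probability.LatticeModels.Site 2 := fun p k => if p.2 = 0 then (![(p.1, p.1), (p.1 + Pi.single 0 1, p.1), (p.1 + Pi.single 0 1, p.1 - Pi.single 1 1), (p.1, p.1 - Pi.single 1 1)] : Fin 4 → Literature.Probability.LatticeModels.Site 2 × Literature.Probability.LatticeModels.Site 2) k else (![(p.1 + Pi.single 1 1, p.1 - Pi.single 0 1), (p.1 + Pi.single 1 1, p.1), (p.1, p.1), (p.1, p.1 - Pi.single 0 1)] : Fin 4 → Literature.Probability.LatticeModels.Site 2 × Literature.Probability.LatticeModels.Site 2) k; let rel : ℂ → (Literature.Probability.LatticeModels.Site 2 × Literature.Probability.LatticeModels.Site 2 → ℂ) → Literature.Probability.LatticeModels.Site 2 × Fin 2 → Prop := fun χ F p => F (corners p 0) - F (corners p 2) = χ * (F (corners p 1) - F (corners p 3)); ∃ χ : ℂ, (χ = Complex.I ∨ χ = -Complex.I)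 ∧ ∀ (D : Literature.Probability.RandomPlanarGeometry.DobrushinDomain) (E : Literature.Probability.LatticeModels.DiscreteDobrushin), E.Ω = D.carrier → E.IsZdAdmissible → ∀ p : Literature.Probability.LatticeModels.Site 2 × Fin 2, (s(p.1, p.1 + Pi.single p.2 1) ∈ (Literature.Probability.LatticeModels.discreteDomainGraph E.Ω E.δ).edgeSet ∧ ∀ x ∈ s(p.1, p.1 + Pi.single p.2 1), x ∉ E.zdArcA ∧ x ∉ E.zdArcB) → (∀ f : Literature.Probability.LatticeModels.Site 2, Literature.Probability.LatticeModels.IsCorner p.1 f → Literature.Probability.LatticeModels.IsCorner (p.1 + Pi.single p.2 1) f → E.IsInnerFace f) → rel χ (G E E.δ) p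

-- item stmt-CriticalPhenomena-8806 · support · rank 9 · open · by planner — informal only, no Lean statement yet:
--   [support] CENSUS (card F1; negative companion, extends barrier FKParafermionicHalfCauchyRiemann).
--   For the spin-s dart observable G^s_δ(c) = E[exp(−is·W(c)); γ traverses c] of the bond-ℤ² (p = 1/2)
--   exploration in Dobrushin domains (inline `dart/G` of SublatticeCoherence with 1/3 replaced by s):
--   (i) EXISTENCE/UNIQUENESS — a fixed linear combination Σ_k a_k G^s(corner k of p) over the four
--   corners of a medial vertex p (clockwise positions NW, NE, SE, SW) vanishes at every interior medial
--   vertex (inner faces both sides) of every admissible Dobrushin domain for some a ≠ 0 iff 3s ∈ ℤ, and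
--   then the s

-- earlier Assembly (stmt-CriticalPhenomena-11308, replaced 2026-08-16T20:07:32Z -> stmt-CriticalPhenomena-16613): retired by None — SublatticeCoherence → EdgeParafermionPrecompact → CoherentParafermionToSLESix → SLESixFamiliesGiveCardy → CardyFormulaZ2
-- earlier Assembly (stmt-CriticalPhenomena-16613, replaced 2026-08-16T20:11:35Z -> stmt-CriticalPhenomena-16614): retired by None — SublatticeCoherence → EdgeParafermionPrecompact → CoherentParafermionToSLESix → CardyFormulaZ2
-- earlier Assembly (stmt-CriticalPhenomena-16614, replaced 2026-08-16T20:26:48Z -> stmt-CriticalPhenomena-16644): retired by None — SublatticeCoherence → EdgeParafermionPrecompact → CoherentParafermionGivesCardy → CardyFormulaZ2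
-- earlier Assembly (stmt-CriticalPhenomena-8756, replaced 2026-08-15T16:45:47Z -> stmt-CriticalPhenomena-11075): retired by None — SublatticeCoherence → EdgeParafermionPrecompact → CoherentParafermionToSLESix → SLESixGivesCardy → CardyFormulaZ2
/-- item stmt-CriticalPhenomena-16644 · assembly · rank 1 · open · by planner
sources: DuminilCopinSmirnov2012Lattice, Smirnov2001, CamiaNewman2007, lean:Summit.CriticalPhenomena.CardyFormulaZ2.Cruxes.SLESixFamiliesGiveCardy.CollarTouchSandwich.SLESixFamiliesGiveCardy_of
[assembly] FRAME WITH THE IDENTIFICATION STEP EXPOSED (restated 2026-08-16, ground repair: the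
earlier pure-logic frame SublatticeCoherence → EdgeParafermionPrecompact →
CoherentParafermionGivesCardy → CardyFormulaZ2 — the type of `closes` — is a propositional tautology
once crux #5 is stated through to the conjunct, and the ground battery closed it by `tauto`):
SublatticeCoherence → EdgeParafermionPrecompact → (SublatticeCoherence → EdgeParafermionPrecompact →
SLE₆ for EVERY Dobrushin domain D and EVERY admissible ℤ²-discretisation family Λ of it whose arcs
and discrete marks converge: the endpoint-re-oriented medial exploration interface of Λ δ under
P_{1/2} converges in law in CurveClass ℂ to chordal SLE₆ — the body of
SLE6LimitZ2AllDiscretisations, verbatim the antecedent of CardyComplexCone's SLESixFamiliesGiveCardy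
stmt-9654) → CardyFormulaZ2. Content = the TAIL SLE₆-for-all-families ⇒ Cardy, LANDED as
Theorems.CardyComplexConeSLESixFamiliesGiveCardy (CollarTouchSandwich.SLESixFamiliesGiveCardy_of:
collared designer Dobrushin domains, Newman cross-cut / bc-open escort sandwich, closed-set
portmanteau, SLE₆ side-arc touch law = Cardy's kernel, Radó continuity of the modulus); -/
@[route_item "route-CriticalPhenomena-CardySublatticeCoherence"]
def Assembly : Prop :=
  SublatticeCoherence → EdgeParafermionPrecompact → (SublatticeCoherence → EdgeParafermionPrecompact → (∀ (D : Literature.Probability.RandomPlanarGeometry.DobrushinDomain) (Λ : ℝ → Literature.Probability.LatticeModels.DiscreteDobrushin), (∀ δ, (Λ δ).Ω = D.carrier) → (∀ δ, (Λ δ).δ = δ) → Filter.Tendsto (fun δ : ℝ => Metric.hausdorffEDist (Λ δ).arcA (D.arc 0)) (nhdsWithin (0:ℝ) (Set.Ioi 0)) (nhds 0) → Filter.Tendsto (fun δ : ℝ => Metric.hausdorffEDist (Λ δ).arcB (D.arc 1)) (nhdsWithin (0:ℝ) (Set.Ioi 0)) (nhds 0) → Filter.Tendsto (fun δ : ℝ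 => Metric.hausdorffEDist (Literature.Probability.LatticeModels.medialPoint δ '' (Λ δ).zdABEdges) {D.pt 0, D.pt 1}) (nhdsWithin (0:ℝ) (Set.Ioi 0)) (nhds 0) → (∀ᶠ δ in nhdsWithin (0:ℝ) (Set.Ioi 0), (Λ δ).IsZdAdmissible) → Literature.Probability.RandomPlanarGeometry.ConvergesInLawToSLE 6 D (Ωδ := fun _ => Literature.Probability.Percolation.BondConfig (Literature.Probability.LatticeModels.Site 2)) (fun δ ω => Literature.Probability.RandomPlanarGeometry.CurveClass.mk (if dist (Literature.Probability.LatticeModels.medialExplorationCurve (Λ δ) ω 0) (D.pt 0) ≤ dist (Literature.Probability.LatticeModels.medialExplorationCurve (Λ δ) ω 0) (D.pt 1) then (⟨Literature.Probability.LatticeModels.medialExplorationCurve (Λ δ) ω⟩ : Literature.Probability.RandomPlanarGeometry.Curve ℂ) else ⟨(Literature.Probability.LatticeModels.medialExplorationCurve (Λ δ) ω).comp ⟨unitInterval.symm, unitInterval.continuous_symm⟩⟩)) (fun _ => Literature.Probability.Percolation.bondPercolation (Literature.Probability.LatticeModels.zdGraph 2) Literature.Probability.Percolation.half))) → Cardy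FormulaZ2

-- records of items no longer active in this route (dropped / restated):
-- earlier CoherentParafermionToSLESix (stmt-CriticalPhenomena-8753, replaced 2026-08-15T16:45:47Z -> stmt-CriticalPhenomena-11072): retired by None — SublatticeCoherence → EdgeParafermionPrecompact → Literature.Probability.Percolation.SLE6LimitZ2
-- earlier DiscretisationFamilyExists (stmt-CriticalPhenomena-9644, dropped 2026-08-16T20:11:35Z): proved by Summit.CriticalPhenomena.CardyFormulaZ2.Theorems.DiscretisationFamilyExists_proof @ 387f8440f586 — ∀ (D : Literature.Probability.RandomPlanarGeometry.DobrushinDomain), ∃ Λ : ℝ → Literature.Probability.LatticeModels.DiscreteDobrushin, (∀ δ, (Λ δ).Ω = D.carrier) ∧ (∀ δ, (Λ δ).δ = δ) ∧ Filter.Ten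
-- earlier SLESixFamiliesGiveCardy (stmt-CriticalPhenomena-9654, dropped 2026-08-16T20:11:35Z): proved by Summit.CriticalPhenomena.CardyFormulaZ2.Cruxes.SLESixFamiliesGiveCardy.CollarTouchSandwich.SLESixFamiliesGiveCardy_of — (∀ (D : Literature.Probability.RandomPlanarGeometry.DobrushinDomain) (Λ : ℝ → Literature.Probability.LatticeModels.DiscreteDobrushin), (∀ δ, (Λ δ).Ω = D.carrier) → (∀ δ, (Λ δ).δ

/-! D-0027 §2.1 — DECIDING THEOREM (planner-authored via `route open/edit --closes-file`; by planner-rbadge-CriticalPhenomena-CardySublatti-5fb5e7f2-g3-0 2026-08-16T20:11:35Z):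
its hypotheses are this route's items and its conclusion the sub-problem Statement (glue_lint), and it elaborates with this file. -/

@[closes "route-CriticalPhenomena-CardySublatticeCoherence"] theorem closes : SublatticeCoherence → EdgeParafermionPrecompact → CoherentParafermionGivesCardy → _root_.CardyFormulaZ2 :=
  fun hCoh hPre hCardy => hCardy hCoh hPre

end Summit.CriticalPhenomena.CardyFormulaZ2.Theses.CardySublatticeCoherence
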